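import Literature.Probability.RandomPlanarGeometry.SchrammLeftPassage
import Literature.Probability.RandomPlanarGeometry.SLESchrammMartingale
import Literature.Probability.RandomPlanarGeometry.CritPercSLESwallowingProofs
import Literature.Probability.RandomPlanarGeometry.LoewnerPointCocycle
import Literature.Probability.Process.NestedStoppedMartingales
import HarnessLib

/-!
# Schramm's left-passage formula for SLE_{8/3}: proof

Topic `Literature/Probability/RandomPlanarGeometry`; theorems only. This file discharges the named
fact `Literature.Probability.RandomPlanarGeometry.Schramm2001_passesLeft_eightThirds`
(`SchrammLeftPassage.lean`):

* O. Schramm, *A percolation formula*, Electron. Comm. Probab. **6** (2001) 115–120,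
  arXiv:math/0107096, **Theorem 2** at `κ = 8/3` in the dynamical form of its proof and Lemma 3:
  for `z₀ = x₀ + i y₀ ∈ ℍ`, `P[w_t → +∞ as t ↑ τ(z₀)] = h(x₀/y₀)`, `h(w) = (1 + w/√(1 + w²))/2`
  (`schrammH`), where `w_t = x_t/y_t`, `x_t + i y_t = g_t(z₀) − W(t)`, `W = √(8/3) B`.

We follow the printed proof (arXiv p. 3). Schramm writes `dw = −dW/y + 4w dt/|z|²`, passes to
the clock `du = dt/y²` in which `w` is the diffusion `dw = −dW̃ + 4w du/(w² + 1)` (5), notes that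
`h(w_u)` is a local martingale for the hitting function `h` of (5), solves
`(κ/2) h'' + (4w/(w² + 1)) h' = 0`, `h = (f − f(a))/(f(b) − f(a))`, `f(w) = ₂F₁(½, 4/κ; 3/2; −w²) w`,
observes that `f(±∞)` is finite for `κ < 8`, concludes "the diffusion process (5) is transient.
Moreover, `P[lim_{u→∞} w_u = +∞] = (f(w₀) − f(−∞))/(f(∞) − f(−∞))`", and appeals to Lemma 3
(left passage iff `w_t → +∞`). At `κ = 8/3`, `f ∝ 2h − 1` with the tree's `schrammH`, and the
tree already has: Schramm's martingale `h(w_{t∧ρₙ})` for every `z ∈ ℍ`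
(`martingale_schrammObsStopped_sle`, the Itô step with the drift killed by Schramm's equation),
the passage events `Loewner.PassesLeft` / `Loewner.PassesRight` (`w_t → ±∞` as `t ↑ T_z`), and
the dominated-convergence assembly `measureReal_passesLeft_eq` giving
`P[passes left] = E[h(w_0)] = h(x₀/y₀)` CONDITIONALLY on the dichotomy "a.s. `w_t → +∞` or
`w_t → −∞`". What is proved here is that dichotomy — Schramm's "the diffusion (5) is transient" —
without the time change, in three steps:

* (limit) `ae_exists_tendsto_comp_cotArg_of_martingale`: if `F` is bounded continuous and the
  processes `F(w_{t∧ρₙ})` are martingales with continuous paths (`ρₙ ↑ T_z` the localizing times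
  `slePointLocTime`), then a.s. `F(w_t)` has a limit `c` as `t ↑ T_z` — the tree's convergence
  theorem for nested stopped bounded continuous martingales
  (`Process.ae_nested_stoppedProcess_tendsto`, Revuz–Yor Ch. II Thm (2.10) / Ch. IV §1);
* (no interior limit) a.s. the slope `w_t` has NO finite limit as `t ↑ T_z`, for every
  `0 < κ < 8`: a finite limit makes `|w|` bounded on some `[r, T_z)`, hence — by the cocycle
  `ψ_{r+u}(z) = ψ_r(z) ψ'_u(z_r)` (`LoewnerPointCocycle`) and Rohde–Schramm's "if `|w|` stays
  bounded then `ψ → ∞` by (6.3)" (`Loewner.tendsto_derivRatio_atTop_of_abs_cotArg_le`) —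
  Rohde–Schramm's ratio `ψ_t = (Im z)|g_t'(z)|/Im g_t(z)` is unbounded on `[0, T_z)`; but by
  Rohde–Schramm's Lemma 6.3 `ψ` is a.s. bounded on `[0, T_z)` (`ae_exists_sleDerivRatio_le`,
  `CritPercSLESwallowingProofs.lean`: `E[supₙ ψ_{ρₙ}^a] ≤ 2`). (This replaces the textbook statement
  "a regular diffusion on natural scale does not converge to an interior point" behind Schramm's
  word "transient"; it is the shorter road in this tree.)
* (dichotomy) `ae_passesLeft_or_passesRight_of_martingale`: for `F` strictly increasing with
  `F(−∞) = 0`, `F(+∞) = 1` the limit `c` is therefore `0` or `1`, i.e. `w_t → −∞` or `+∞`;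
  at `κ = 8/3` with `F = h` this is `ae_passesLeft_or_passesRight_sle_eightThirds`, and
  `Schramm2001_passesLeft_eightThirds_holds` follows from `measureReal_passesLeft_eq` and
  `E[h(w_{t∧ρₙ})] = h(x₀/y₀)` (optional stopping, `integral_schrammObsStopped_sle_eq_schrammH`).

The general-`κ` statements are kept general (`0 < κ < 8`, an abstract scale function `F`) so
that the named fact `Schramm2001_slope_dichotomy` (all `κ ∈ (0,8)`) reduces to the martingale
property of `s_κ(w_{t∧ρₙ})`, `s_κ' = (1 + w²)^{−4/κ}`, by `ae_passesLeft_or_passesRight_of_martingale`.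

## References

* O. Schramm, *A percolation formula*, Electron. Comm. Probab. 6 (2001), Thm. 2, Lemma 3 and the
  proof of Thm. 2 (arXiv:math/0107096, p. 3). [Schramm2001Percolation]
* S. Rohde, O. Schramm, *Basic properties of SLE*, Ann. of Math. 161 (2005), Lemma 6.3 and its
  proof (pp. 903–906), eq. (6.3). [RohdeSchramm2005]
* D. Revuz, M. Yor, *Continuous Martingales and Brownian Motion* (1999), Ch. II Thm (2.10),
  Ch. IV §1, Ch. VII §3. [RevuzYor1999]
-/

noncomputable section

open Set Filter MeasureTheory Complex
open _root_.Topology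
open scoped NNReal ENNReal

namespace Literature.Probability.RandomPlanarGeometry

open Loewner Literature.Probability.Process

/-! ### Pathwise: a bounded slope after some time forces `ψ → ∞` (cocycle form of RS (6.3)) -/

namespace Loewner

variable {W : ℝ≥0 → ℝ} {z : ℂ}

/-- **If `|w_t| ≤ s` on `[r, T_z)` for some `r < T_z`, then `ψ` is unbounded on `[0, T_z)`.**
Restart the flow at time `r` from `z_r` with the increments `W(r + ·) − W(r)`
(`LoewnerPointCocycle`): the restarted slope is `w_{r+u}`, bounded by `s` up to its swallowing
time, so the restarted ratio `ψ'_u → ∞` (Rohde–Schramm (2005), p. 905: "if `|Re g_t/Im g_t|` never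
hits `|w₀|`, then `Z = ∞`, by (6.3)", `tendsto_derivRatio_atTop_of_abs_cotArg_le`), and
`ψ_{r+u} = ψ_r ψ'_u ≥ ψ'_u`. [cite: RohdeSchramm2005, Lemma 6.3 (proof, eq. (6.3))] -/
theorem exists_lt_derivRatio_of_abs_cotArg_add_le (hW : Continuous W) (hz : 0 < z.im) {r : ℝ≥0}
    (hr : (r : WithTop ℝ≥0) < swallowingTime W z) {s : ℝ}
    (hs : ∀ u : ℝ≥0, ((r + u : ℝ≥0) : WithTop ℝ≥0) < swallowingTime W z → |cotArg W z (r + u)| ≤ s)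
    (S : ℝ) : ∃ t : ℝ≥0, (t : WithTop ℝ≥0) < swallowingTime W z ∧ S < derivRatio W z t := by
  set W' : ℝ≥0 → ℝ := incrDriving W r with hW'def
  set z' : ℂ := centredMap W r z with hz'def
  have hW' : Continuous W' := continuous_incrDriving hW r
  have hz' : 0 < z'.im := im_centredMap_pos hW hz hr
  have hs' : ∀ u : ℝ≥0, (u : WithTop ℝ≥0) < swallowingTime W' z' → |cotArg W' z' u| ≤ s := by
    intro u hu
    have hru := (coe_add_lt_swallowingTime_iff_incr hW hz hr u).2 hu
    rw [hW'def, hz'def, ← cotArg_add_eq_incr hW hru]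
    exact hs u hru
  have hlim := tendsto_derivRatio_atTop_of_abs_cotArg_le hW' hz' hs'
  haveI : Nonempty {u : ℝ≥0 // (u : WithTop ℝ≥0) < swallowingTime W' z'} :=
    ⟨⟨0, coe_zero_lt_swallowingTime hW' hz'⟩⟩
  obtain ⟨u, hu⟩ := (hlim.eventually (eventually_gt_atTop S)).exists
  have hru := (coe_add_lt_swallowingTime_iff_incr hW hz hr u).2 u.2
  refine ⟨r + u, hru, ?_⟩
  rw [derivRatio_add_eq_incr hW hz hru]
  have h1 : 1 ≤ derivRatio W z r := one_le_derivRatio hW hz hr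
  have h2 : 1 ≤ derivRatio W' z' u := one_le_derivRatio hW' hz' u.2
  calc S < derivRatio W' z' u := hu
    _ ≤ derivRatio W z r * derivRatio W' z' u :=
        le_mul_of_one_le_left (zero_le_one.trans h2) h1

/-- **A finite limit of the slope makes it bounded after some time**: if `w_t → L` as `t ↑ T_z`
then `|w_t| ≤ |L| + 1` on `[r, T_z)` for some `r < T_z`. [folklore] -/
theorem exists_abs_cotArg_add_le_of_tendsto (hW : Continuous W) (hz : 0 < z.im) {L : ℝ}
    (h : Tendsto (fun t : {t : ℝ≥0 // (t : WithTop ℝ≥0) < swallowingTime W z} ↦ cotArg W z t)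
      atTop (𝓝 L)) :
    ∃ r : ℝ≥0, (r : WithTop ℝ≥0) < swallowingTime W z ∧
      ∀ u : ℝ≥0, ((r + u : ℝ≥0) : WithTop ℝ≥0) < swallowingTime W z →
        |cotArg W z (r + u)| ≤ |L| + 1 := by
  haveI : Nonempty {t : ℝ≥0 // (t : WithTop ℝ≥0) < swallowingTime W z} :=
    ⟨⟨0, coe_zero_lt_swallowingTime hW hz⟩⟩
  have h1 : ∀ᶠ t : {t : ℝ≥0 // (t : WithTop ℝ≥0) < swallowingTime W z} in atTop,
      dist (cotArg W z t) L < 1 := (Metric.tendsto_nhds.1 h) 1 one_pos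
  obtain ⟨r, hr⟩ := eventually_atTop.1 h1
  refine ⟨r, r.2, fun u hru ↦ ?_⟩
  have h2 := hr ⟨(r : ℝ≥0) + u, hru⟩ (Subtype.coe_le_coe.1 (le_self_add : (r : ℝ≥0) ≤ r + u))
  rw [Real.dist_eq] at h2
  have h3 := abs_add_le (cotArg W z (r + u) - L) L
  rw [sub_add_cancel] at h3
  linarith [h3, h2.le]

end Loewner

/-! ### Almost surely the slope has no finite limit at `T_z−`, for `κ < 8` -/

section Ratio

variable {κ : ℝ≥0} {z : ℂ}

/-- **For `0 < κ < 8`, almost surely the slope `w_t` has no finite limit as `t ↑ T_z`**: a finite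
limit bounds `|w|` after some time (`Loewner.exists_abs_cotArg_add_le_of_tendsto`), which makes
`ψ` unbounded (`Loewner.exists_lt_derivRatio_of_abs_cotArg_add_le`), against the a.s. boundedness
of `ψ` on `[0, T_z)` (`ae_exists_sleDerivRatio_le`, Rohde–Schramm's Lemma 6.3). This is the
"no interior limit" half of Schramm's "the diffusion (5) is transient".
[cite: Schramm2001Percolation, Thm. 2 (proof, "the diffusion process is transient")] -/
theorem ae_not_tendsto_cotArg_nhds (hκ0 : 0 < κ) (hκ8 : κ < 8) (hz : 0 < z.im) :
    ∀ᵐ ω ∂preWienerMeasure, ∀ L : ℝ,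
      ¬ Tendsto (fun t : {t : ℝ≥0 // (t : WithTop ℝ≥0) < swallowingTime (sleDriving κ ω) z} ↦
        cotArg (sleDriving κ ω) z t) atTop (𝓝 L) := by
  filter_upwards [ae_exists_sleDerivRatio_le hκ0 hκ8 hz] with ω ⟨S, hS⟩ L hL
  have hW : Continuous (sleDriving κ ω) := continuous_sleDriving κ ω
  obtain ⟨r, hr, hs⟩ := exists_abs_cotArg_add_le_of_tendsto hW hz hL
  obtain ⟨t, ht, hSt⟩ := exists_lt_derivRatio_of_abs_cotArg_add_le hW hz hr hs S
  exact absurd (hS t ht) (not_le.2 hSt)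

end Ratio

/-! ### A bounded local martingale `F(w_t)` has an almost sure limit at `T_z−` -/

section Limit

variable {κ : ℝ≥0} {z : ℂ}

/-- The process `F(w_{t ∧ ρₙ})` (stopped at the localizing time `ρₙ = slePointLocTime κ z n`) has
continuous paths, for `F` continuous: it is `F` of the quotient of the stopped flows `x^{ρₙ}/y^{ρₙ}`
(`SLEPointFlowStopped`).
[folklore] -/
theorem continuous_stoppedProcess_comp_cotArg (hz : 0 < z.im) {F : ℝ → ℝ} (hF : Continuous F)
    (n : ℕ) (ω : ℝ≥0 → ℝ) :
    Continuous fun t ↦ stoppedProcess (fun t ω ↦ F (cotArg (sleDriving κ ω) z t))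
      (slePointLocTime κ z n) t ω := by
  have hσρ : ∀ ω, slePointLocTime κ z n ω ≤ slePointLocTime κ z n ω := fun _ ↦ le_rfl
  have h : (fun t ↦ stoppedProcess (fun t ω ↦ F (cotArg (sleDriving κ ω) z t))
      (slePointLocTime κ z n) t ω) =
        fun t ↦ F (stoppedProcess (slePointRe κ z) (slePointLocTime κ z n) t ω /
          stoppedProcess (slePointIm κ z) (slePointLocTime κ z n) t ω) := by
    funext t
    rw [stopped_div_eq_cotArg hz hσρ t ω]
    rfl
  rw [h]
  exact hF.comp ((continuous_stoppedProcess_slePointRe hz hσρ ω).div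
    (continuous_stoppedProcess_slePointIm hz _ ω)
    fun t ↦ (stoppedProcess_slePointIm_pos hz hσρ t ω).ne')

/-- **Almost sure limit at `T_z−` of a bounded local martingale of the slope.** If `F` is
continuous and bounded and every stopped process `F(w_{· ∧ ρₙ})` is a martingale of the raw
Brownian filtration (Schramm (2001), proof of Thm. 2: "`h(w_u)` is a local martingale"; the
`ρₙ ↑ τ(z)` of Rohde–Schramm (2005), p. 905), then almost surely `F(w_t)` converges as
`t ↑ T_z` — the martingale convergence theorem in the nested-stopped form
`Process.ae_nested_stoppedProcess_tendsto` (Revuz–Yor (1999), Ch. II Thm (2.10), Ch. IV §1), the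
localizing times being finite (`≤ n + 1`), non-decreasing in `n`, `< T_z`, and exhausting
`[0, T_z)` (`exists_le_slePointLocTime`). [cite: RevuzYor1999, Ch. II Thm (2.10)] -/
theorem ae_exists_tendsto_comp_cotArg_of_martingale (hz : 0 < z.im) {F : ℝ → ℝ}
    (hF : Continuous F) {C : ℝ} (hC : ∀ w, |F w| ≤ C)
    (hmart : ∀ n, Martingale (stoppedProcess (fun t ω ↦ F (cotArg (sleDriving κ ω) z t))
      (slePointLocTime κ z n)) brownianFiltration preWienerMeasure) :
    ∀ᵐ ω ∂preWienerMeasure, ∃ c : ℝ,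
      Tendsto (fun t : {t : ℝ≥0 // (t : WithTop ℝ≥0) < swallowingTime (sleDriving κ ω) z} ↦
        F (cotArg (sleDriving κ ω) z t)) atTop (𝓝 c) := by
  haveI : IsProbabilityMeasure preWienerMeasure := isProbabilityMeasure_preWienerMeasure'
  have h := ae_nested_stoppedProcess_tendsto (P := preWienerMeasure) (𝓕 := brownianFiltration)
    (Y := fun t ω ↦ F (cotArg (sleDriving κ ω) z t)) (τ := slePointLocTime κ z) (C := C)
    (fun ω ↦ slePointLocTime_mono hz ω)
    (fun k ↦ (isStoppingTime_slePointLocTime κ hz k).isOptionalTime) hmart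
    (fun t ω ↦ hC _) (fun k ↦ ae_of_all _ fun ω ↦ continuous_stoppedProcess_comp_cotArg hz hF k ω)
  filter_upwards [h] with ω hω
  obtain ⟨c, hc⟩ := hω fun k ↦ slePointLocTime_ne_top k ω
  refine ⟨c, ?_⟩
  haveI : Nonempty {t : ℝ≥0 // (t : WithTop ℝ≥0) < swallowingTime (sleDriving κ ω) z} :=
    ⟨⟨0, coe_zero_lt_swallowingTime (continuous_sleDriving κ ω) hz⟩⟩
  rw [Metric.tendsto_atTop]
  intro ε hε
  obtain ⟨K, hK⟩ := hc (ε / 2) (half_pos hε)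
  have hρK : (((slePointLocTime κ z K ω).untopA : ℝ≥0) : WithTop ℝ≥0) <
      swallowingTime (sleDriving κ ω) z := by
    rw [coe_untopA_slePointLocTime]
    exact slePointLocTime_lt_swallowingTime hz K ω
  refine ⟨⟨(slePointLocTime κ z K ω).untopA, hρK⟩, fun t ht ↦ ?_⟩
  obtain ⟨N, hN⟩ := exists_le_slePointLocTime hz ω t.2
  have hKt : slePointLocTime κ z K ω ≤ ((t : ℝ≥0) : WithTop ℝ≥0) := by
    rw [← coe_untopA_slePointLocTime K ω]
    exact WithTop.coe_le_coe.2 (Subtype.coe_le_coe.2 ht)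
  have hJ := hK (max K N) (le_max_left _ _) (t : ℝ≥0) hKt
  have heq : stoppedProcess (fun t ω ↦ F (cotArg (sleDriving κ ω) z t))
      (slePointLocTime κ z (max K N)) t ω = F (cotArg (sleDriving κ ω) z t) := by
    show F (cotArg (sleDriving κ ω) z
      ((min ((t : ℝ≥0) : WithTop ℝ≥0) (slePointLocTime κ z (max K N) ω)).untopA)) = _
    rw [min_eq_left (hN (max K N) (le_max_right _ _))]
    rfl
  rw [heq] at hJ
  rw [Real.dist_eq]
  linarith [hJ]

/-- Order-theoretic un-composition of a limit: if `F` is strictly increasing and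
`F(g_a) → F(L)` then `g_a → L`. [folklore] -/
theorem tendsto_of_tendsto_comp_strictMono {α : Type*} {l : Filter α} {F : ℝ → ℝ}
    (hmono : StrictMono F) {g : α → ℝ} {L : ℝ}
    (h : Tendsto (fun a ↦ F (g a)) l (𝓝 (F L))) : Tendsto g l (𝓝 L) := by
  rw [tendsto_order] at h ⊢
  refine ⟨fun a ha ↦ ?_, fun b hb ↦ ?_⟩
  · filter_upwards [h.1 (F a) (hmono ha)] with x hx
    exact hmono.lt_iff_lt.1 hx
  · filter_upwards [h.2 (F b) (hmono hb)] with x hx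
    exact hmono.lt_iff_lt.1 hx

/-- **The slope dichotomy from a scale-function martingale** (Schramm (2001), proof of Thm. 2:
"the diffusion process (5) is transient. Moreover `P[lim w_u = +∞] = (f(w₀) − f(−∞))/(f(∞) − f(−∞))`").
Let `0 < κ < 8`, `z ∈ ℍ`, and let `F : ℝ → ℝ` be continuous, strictly increasing, with `F → 0` at
`−∞` and `F → 1` at `+∞` (a normalized scale function), such that every `F(w_{· ∧ ρₙ})` is a
martingale. Then almost surely `w_t → +∞` or `w_t → −∞` as `t ↑ T_z` (`Loewner.PassesLeft` or
`Loewner.PassesRight`): `F(w_t)` has a limit `c ∈ [0, 1]`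
(`ae_exists_tendsto_comp_cotArg_of_martingale`); `c ∈ (0, 1)` would make `w_t → F⁻¹(c)`, excluded
by `ae_not_tendsto_cotArg_nhds`; `c = 1` (resp. `0`) forces `w_t → +∞` (resp. `−∞`).
[cite: Schramm2001Percolation, Thm. 2 (proof, "the diffusion process is transient")] -/
theorem ae_passesLeft_or_passesRight_of_martingale (hκ0 : 0 < κ) (hκ8 : κ < 8) (hz : 0 < z.im)
    {F : ℝ → ℝ} (hF : Continuous F) (hmono : StrictMono F)
    (h0 : Tendsto F atBot (𝓝 0)) (h1 : Tendsto F atTop (𝓝 1))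
    (hmart : ∀ n, Martingale (stoppedProcess (fun t ω ↦ F (cotArg (sleDriving κ ω) z t))
      (slePointLocTime κ z n)) brownianFiltration preWienerMeasure) :
    ∀ᵐ ω ∂preWienerMeasure,
      PassesLeft (fun s ↦ sleDriving κ ω s) z ∨ PassesRight (fun s ↦ sleDriving κ ω s) z := by
  have hF1 : ∀ w, F w ≤ 1 := fun w ↦ hmono.monotone.ge_of_tendsto h1 w
  have hF0 : ∀ w, 0 ≤ F w := fun w ↦ hmono.monotone.le_of_tendsto h0 w
  have hC : ∀ w, |F w| ≤ 1 := fun w ↦ abs_le.2 ⟨by linarith [hF0 w], hF1 w⟩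
  filter_upwards [ae_exists_tendsto_comp_cotArg_of_martingale hz hF hC hmart,
    ae_not_tendsto_cotArg_nhds hκ0 hκ8 hz] with ω hω hnot
  obtain ⟨c, hc⟩ := hω
  have hW : Continuous (sleDriving κ ω) := continuous_sleDriving κ ω
  haveI : Nonempty {t : ℝ≥0 // (t : WithTop ℝ≥0) < swallowingTime (sleDriving κ ω) z} :=
    ⟨⟨0, coe_zero_lt_swallowingTime hW hz⟩⟩
  have hc0 : 0 ≤ c := ge_of_tendsto' hc fun t ↦ hF0 _
  have hc1 : c ≤ 1 := le_of_tendsto' hc fun t ↦ hF1 _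
  rcases eq_or_lt_of_le hc1 with hc1 | hc1
  · -- `c = 1`: `w_t → +∞`
    left
    show Tendsto (fun t : {t : ℝ≥0 // (t : WithTop ℝ≥0) < swallowingTime (sleDriving κ ω) z} ↦
      cotArg (sleDriving κ ω) z t) atTop atTop
    rw [tendsto_atTop]
    intro M
    have hM : F M < c := by
      rw [hc1]; exact lt_of_lt_of_le (hmono (lt_add_one M)) (hF1 _)
    filter_upwards [(tendsto_order.1 hc).1 (F M) hM] with t ht
    exact (hmono.lt_iff_lt.1 ht).le
  rcases eq_or_lt_of_le hc0 with hc0 | hc0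
  · -- `c = 0`: `w_t → −∞`
    right
    show Tendsto (fun t : {t : ℝ≥0 // (t : WithTop ℝ≥0) < swallowingTime (sleDriving κ ω) z} ↦
      cotArg (sleDriving κ ω) z t) atTop atBot
    rw [tendsto_atBot]
    intro M
    have hM : c < F M := by
      rw [← hc0]; exact lt_of_le_of_lt (hF0 _) (hmono (sub_one_lt M))
    filter_upwards [(tendsto_order.1 hc).2 (F M) hM] with t ht
    exact (hmono.lt_iff_lt.1 ht).le
  · -- `0 < c < 1`: the slope would have the finite limit `F⁻¹(c)`
    exfalso
    obtain ⟨a, ha⟩ : ∃ a, F a < c := (h0.eventually (gt_mem_nhds hc0)).exists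
    obtain ⟨b, hb⟩ : ∃ b, c < F b := (h1.eventually (lt_mem_nhds hc1)).exists
    have hab : a ≤ b := (hmono.lt_iff_lt.1 (ha.trans hb)).le
    obtain ⟨L, -, hL⟩ : c ∈ F '' Icc a b :=
      intermediate_value_Icc hab hF.continuousOn ⟨ha.le, hb.le⟩
    rw [← hL] at hc
    exact hnot L (tendsto_of_tendsto_comp_strictMono hmono hc)

end Limit

/-! ### `κ = 8/3`: Schramm's function is the scale function, and Theorem 2 -/

section EightThirds

variable {z : ℂ}

/-- `h` is strictly increasing (`h' = 1/(2(1 + w²)^{3/2}) > 0`). [cite: Schramm2001Percolation, Thm. 2 (proof)] -/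
theorem strictMono_schrammH : StrictMono schrammH :=
  strictMono_of_deriv_pos fun w ↦ by
    rw [deriv_schrammH]
    dsimp only
    positivity

/-- The stopped process of `h(w_t)` at `ρₙ` is the tree's stopped observable `schrammObsStopped`
(`S_t = h(w_t)` before the swallowing time, `schrammObs_eq_schrammH`). [folklore] -/
theorem stoppedProcess_schrammH_cotArg_eq (κ : ℝ≥0) (hz : 0 < z.im) (n : ℕ) :
    stoppedProcess (fun t ω ↦ schrammH (cotArg (sleDriving κ ω) z t)) (slePointLocTime κ z n) =
      schrammObsStopped (fun s ω ↦ sleDriving κ ω s) z n := by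
  funext t ω
  have hT := coe_untopA_min_lt_swallowingTime (σ := slePointLocTime κ z n) (n := n) hz
    (fun _ ↦ le_rfl) t ω
  rw [schrammObsStopped_apply]
  change schrammH (cotArg (sleDriving κ ω) z
      ((min ((t : ℝ≥0) : WithTop ℝ≥0) (slePointLocTime κ z n ω)).untopA)) =
    schrammObs (sleDriving κ ω) z ((min ((t : ℝ≥0) : WithTop ℝ≥0) (slePointLocTime κ z n ω)).untopA)
  rw [schrammObs_eq_schrammH (continuous_sleDriving κ ω) hz hT]

/-- **The slope dichotomy for SLE_{8/3}** (Schramm (2001), proof of Thm. 2 at `κ = 8/3`: the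
diffusion (5) is transient, with scale function `f ∝ 2h − 1`): for `z ∈ ℍ`, almost surely
`w_t → +∞` or `w_t → −∞` as `t ↑ T_z` — from `ae_passesLeft_or_passesRight_of_martingale` with
`F = h` and Schramm's martingale `martingale_schrammObsStopped_sle`. This is the hypothesis `hd`
of the tree's `measureReal_passesLeft_sle_eq_half`, and the `κ = 8/3` instance of the named fact
`Schramm2001_slope_dichotomy`. [cite: Schramm2001Percolation, Thm. 2 (proof) and Lemma 3] -/
theorem ae_passesLeft_or_passesRight_sle_eightThirds (hz : 0 < z.im) :
    ∀ᵐ ω ∂preWienerMeasure, PassesLeft (fun s ↦ sleDriving (8 / 3) ω s) z ∨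
      PassesRight (fun s ↦ sleDriving (8 / 3) ω s) z := by
  have h83 : (0 : ℝ≥0) < 8 / 3 := by positivity
  have h83' : (8 : ℝ≥0) / 3 < 8 := by
    rw [div_lt_iff₀ (by norm_num : (0 : ℝ≥0) < 3)]
    norm_num
  refine ae_passesLeft_or_passesRight_of_martingale h83 h83' hz continuous_schrammH
    strictMono_schrammH tendsto_schrammH_atBot tendsto_schrammH_atTop fun n ↦ ?_
  rw [stoppedProcess_schrammH_cotArg_eq (8 / 3) hz n]
  exact martingale_schrammObsStopped_sle hz n

/-- **`E[h(w_{t ∧ ρₙ})] = h(Re z/Im z)`** for SLE_{8/3} (optional stopping for Schramm's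
martingale: "`P[lim w_u = +∞] = (f(w₀) − f(−∞))/(f(∞) − f(−∞))`" before the limits).
[cite: Schramm2001Percolation, Thm. 2 (proof)] -/
theorem integral_schrammObsStopped_sle_eq_schrammH (hz : 0 < z.im) (n : ℕ) (t : ℝ≥0) :
    ∫ ω, schrammObsStopped (fun s ω ↦ sleDriving (8 / 3) ω s) z n t ω ∂preWienerMeasure =
      schrammH (z.re / z.im) := by
  haveI : IsProbabilityMeasure preWienerMeasure := isProbabilityMeasure_preWienerMeasure'
  have h := martingale_schrammObsStopped_sle hz n
  have h1 := h.setIntegral_eq (zero_le : (0 : ℝ≥0) ≤ t) (s := univ) MeasurableSet.univ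
  rw [setIntegral_univ, setIntegral_univ] at h1
  rw [← h1]
  have h2 : (fun ω ↦ schrammObsStopped (fun s ω ↦ sleDriving (8 / 3) ω s) z n 0 ω) =
      fun _ ↦ schrammH (z.re / z.im) := funext fun ω ↦ schrammObsStopped_sle_zero _ hz n ω
  rw [h2]
  simp

/-- **Schramm's left-passage formula at `κ = 8/3`** (Schramm (2001), Thm. 2 with Lemma 3):
DISCHARGE of the named fact `Schramm2001_passesLeft_eightThirds` — for every `z ∈ ℍ` the
pre-Wiener measure of `Loewner.PassesLeft` for the SLE_{8/3} driving function is `h(Re z/Im z)`.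
Two dominated-convergence passages (`measureReal_passesLeft_eq`) fed with the dichotomy
(`ae_passesLeft_or_passesRight_sle_eightThirds`), Schramm's martingale and
`E[h(w_{t∧ρₙ})] = h(Re z/Im z)`. [cite: Schramm2001Percolation, Thm. 2 (κ = 8/3) with Lemma 3] -/
theorem Schramm2001_passesLeft_eightThirds_holds : Schramm2001_passesLeft_eightThirds := by
  intro z hz
  exact measureReal_passesLeft_eq hz (ae_of_all _ fun ω ↦ continuous_sleDriving _ ω)
    (ae_passesLeft_or_passesRight_sle_eightThirds hz)
    (fun n t ↦ ((martingale_schrammObsStopped_sle hz n).integrable t).aestronglyMeasurable)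
    fun t ↦ Eventually.of_forall fun n ↦ integral_schrammObsStopped_sle_eq_schrammH hz n t

end EightThirds

end Literature.Probability.RandomPlanarGeometry

end
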